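import Literature.Analysis.FunctionSpaces.TorusClassicalNSUniqueness
import Literature.Analysis.FunctionSpaces.TorusLinearisedNSEnergy
import Literature.Analysis.FunctionSpaces.TorusFluidGlueProofs

/-!
# Route DopplerClock (AnomalousDissipation) — crux `QuadratureStressFloor`
# (stmt-AnomalousDissipation-18129), line `laminar-burst-shadowing`: stub `stub_perturbationEnergyBalance`

Sorry-free discharge of the registered stub `stub_perturbationEnergyBalance` of the lead's skeleton
(`Cruxes/QuadratureStressFloor/Lines/Sketch.lean`), over tree constants only
(`Torus.IsClassicalNSSolutionOn`, `Torus.kineticEnergy`, `Torus.gradNormSq`, `Torus.convect`).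

**Statement (Serrin's perturbation-energy identity).** Let `(U, q)` be a STEADY classical solution of
the forced incompressible Navier–Stokes system `NS_ν(f)` on `T³` (a classical solution on the time set
`ℝ` with time-independent velocity, pressure and force), and let `(u, p)` be a classical solution of the
SAME forced system on a convex time set `S`. Then for every `t ∈ S` the perturbation energy
`s ↦ ½‖u(s) − U‖₂²` has, within `S` at `t`, the one-sided derivative
`−ν‖∇(u(t) − U)‖₂² − ∫ ⟪u(t) − U, ((u(t) − U)·∇)U⟫`:
the force and the pressures drop out and the cubic transport term vanishes by incompressibility
(J. Serrin, *On the stability of viscous fluid motions*, Arch. Rational Mech. Anal. 3 (1959), §2, the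
energy identity behind the energy-stability method; Doering–Gibbon 1995, Ch. 2; the same computation as
Majda–Bertozzi 2002, Prop. 3.1 / Cor. 3.1 for the difference of two solutions).

**Proof.** This is the computation of the tree's
`Torus.IsClassicalNSSolutionOn.energy_deriv_sub_le` (`TorusClassicalNSUniqueness`) with `u₁ = u`,
`u₂ = U`, on a general convex time set handled as in `Torus.IsClassicalNSSolutionOn.energy_balance_holds`
(`TorusFluidGlueProofs`): at a point of `S` which is not an accumulation point the claim is vacuous
(`HasFDerivWithinAt.of_not_accPt`); otherwise `S` has nonempty interior and is a set of unique
differentiability (`uniqueDiffOn_convex`). Writing `w = u − U`,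
* `∂ₜw = ν Δw − ((u·∇)w + (w·∇)U) − ∇(p − q)` pointwise on `S × T³`
  (`perturbationEnergyBalance_timeDerivWithin_eq`: subtract the two momentum equations; the steady
  state has `∂ₜU = 0`; `(u·∇)u − (U·∇)U = (u·∇)w + (w·∇)U`);
* `∫ ⟪∂ₜw, w⟫ = −ν‖∇w‖₂² − ∫ ⟪w, (w·∇)U⟫`
  (`perturbationEnergyBalance_integral_inner_timeDerivWithin`: `∫ ⟪(u·∇)w, w⟫ = 0` since `div u = 0`,
  `Torus.integral_inner_convect_self_right_eq_zero`; `∫ ⟪∇(p − q), w⟫ = 0` since `div w = 0`,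
  `Torus.integral_inner_gradient_eq_zero_of_isDivFree`; `∫ ⟪Δw, w⟫ = −‖∇w‖₂²`,
  `Torus.integral_inner_laplacian_self_eq_neg_gradNormSq_of_isSmooth`);
* `d/ds ½∫‖w‖² = ½ ∫ ∂ₜ‖w‖² = ∫ ⟪∂ₜw, w⟫` (differentiation under the integral on the compact torus
  within the convex `S`, `Torus.IsSmoothSpaceTimeOn.hasDerivWithinAt_integral`, and
  `∂ₜ‖w‖² = 2⟪w, ∂ₜw⟫`).

No new definitions; no named facts are used.
-/

-- `Summit.<Summit>.<Problem>` is the tree's mandated summit-side namespace (CONVENTIONS §2); for this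
-- single-conjunct summit the two coincide, so the duplicate is deliberate.
set_option linter.dupNamespace false

noncomputable section

open MeasureTheory Set Filter Topology
open scoped InnerProductSpace ContDiff

namespace Summit.AnomalousDissipation.AnomalousDissipation.Theorems

open Literature.Analysis.FunctionSpaces Literature.Analysis.FunctionSpaces.Torus

section PerturbationEnergyBalance

variable {ν : ℝ} {S : Set ℝ} {f U : UnitAddTorus (Fin 3) → EuclideanSpace ℝ (Fin 3)}
  {q : UnitAddTorus (Fin 3) → ℝ} {u : ℝ → UnitAddTorus (Fin 3) → EuclideanSpace ℝ (Fin 3)}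
  {p : ℝ → UnitAddTorus (Fin 3) → ℝ}

/-- **The equation for the perturbation about a steady state.** If `(U, q)` is a steady classical
solution of `NS_ν(f)` on `T³` and `(u, p)` a classical solution of the same forced system on a time
set `S` of unique differentiability, then `w = u − U` satisfies
`∂ₜw = ν Δw − ((u·∇)w + (w·∇)U) − ∇(p − q)` pointwise on `S × T³` (subtract the momentum equations:
the force cancels, `∂ₜU = 0`, and `(u·∇)u − (U·∇)U = (u·∇)w + (w·∇)U`). [folklore] -/
theorem perturbationEnergyBalance_timeDerivWithin_eq
    (hU : IsClassicalNSSolutionOn univ ν (fun _ => f) (fun _ => U) (fun _ => q))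
    (hu : IsClassicalNSSolutionOn S ν (fun _ => f) u p) (hSU : UniqueDiffOn ℝ S) {t : ℝ}
    (ht : t ∈ S) (x : UnitAddTorus (Fin 3)) :
    timeDerivWithin S (fun s y => u s y - U y) t x =
      ν • Torus.laplacian (fun y => u t y - U y) x -
        (Torus.convect (u t) (fun y => u t y - U y) x +
          Torus.convect (fun y => u t y - U y) U x) -
        Torus.gradient (fun y => p t y - q y) x := by
  have hm₁ := hu.momentum t ht x
  -- the steady momentum equation (`∂ₜU = 0`)
  have hm₂ : Torus.convect U U x = ν • Torus.laplacian U x - Torus.gradient q x + f x := by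
    have h := hU.momentum t (mem_univ t) x
    have h0 : timeDerivWithin univ (fun _ : ℝ => U) t x = 0 := by
      simp [Torus.timeDerivWithin]
    rw [h0, zero_add] at h
    exact h
  have hus : IsSmooth (u t) := hu.smooth_velocity.isSmooth_slice ht
  have hUs : IsSmooth U := hU.smooth_velocity.isSmooth_slice (mem_univ t)
  have hs₁ : IsContDiff 1 (u t) := hus.isContDiff (by simp)
  have hs₂ : IsContDiff 1 U := hUs.isContDiff (by simp)
  have hq₁ : IsContDiff 1 (p t) := (hu.smooth_pressure.isSmooth_slice ht).isContDiff (by simp)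
  have hq₂ : IsContDiff 1 q :=
    (hU.smooth_pressure.isSmooth_slice (mem_univ t)).isContDiff (by simp)
  -- the time derivative of the perturbation is that of `u`
  have hdt : timeDerivWithin S (fun s y => u s y - U y) t x = timeDerivWithin S u t x :=
    ((hu.smooth_velocity.hasDerivWithinAt_slice ht x).sub_const (U x)).derivWithin (hSU t ht)
  -- the convective terms: `(u·∇)u − (U·∇)U = (u·∇)w + (w·∇)U`
  have hconv : Torus.convect (u t) (u t) x - Torus.convect U U x =
      Torus.convect (u t) (fun y => u t y - U y) x +
        Torus.convect (fun y => u t y - U y) U x := by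
    have hw : (fun y => u t y - U y) = u t - U := rfl
    simp only [Torus.convect, hw, Torus.fderiv_sub hs₁ hs₂, sub_apply, map_sub]
    abel
  have hgrad : Torus.gradient (fun y => p t y - q y) x =
      Torus.gradient (p t) x - Torus.gradient q x := by
    have hq : (fun y => p t y - q y) = p t - q := rfl
    rw [hq, Torus.gradient_sub hq₁ hq₂]
  have hlap : Torus.laplacian (fun y => u t y - U y) x =
      Torus.laplacian (u t) x - Torus.laplacian U x := by
    have hw : (fun y => u t y - U y) = u t - U := rfl
    rw [hw, Torus.laplacian_sub hus hUs, Pi.sub_apply]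
  rw [hdt, hgrad, hlap, ← hconv, smul_sub, eq_sub_of_add_eq hm₁, hm₂]
  abel

/-- **The energy flux of the perturbation.** Under the hypotheses of
`perturbationEnergyBalance_timeDerivWithin_eq`, with `w = u(t) − U`,
`∫ ⟪∂ₜw, w⟫ = −ν‖∇w‖₂² − ∫ ⟪w, (w·∇)U⟫`: the transport term `∫ ⟪(u·∇)w, w⟫` vanishes because
`div u = 0`, the pressure term `∫ ⟪∇(p − q), w⟫` because `div w = 0`, and `∫ ⟪Δw, w⟫ = −‖∇w‖₂²`
(Serrin 1959, §2; Majda–Bertozzi 2002, Prop. 3.1). [folklore] -/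
theorem perturbationEnergyBalance_integral_inner_timeDerivWithin
    (hU : IsClassicalNSSolutionOn univ ν (fun _ => f) (fun _ => U) (fun _ => q))
    (hu : IsClassicalNSSolutionOn S ν (fun _ => f) u p) (hSU : UniqueDiffOn ℝ S) {t : ℝ}
    (ht : t ∈ S) :
    ∫ x, ⟪timeDerivWithin S (fun s y => u s y - U y) t x, u t x - U x⟫_ℝ =
      -(ν * gradNormSq (fun x => u t x - U x)) -
        ∫ x, ⟪u t x - U x, Torus.convect (fun y => u t y - U y) U x⟫_ℝ := by
  have hut : IsSmooth (u t) := hu.smooth_velocity.isSmooth_slice ht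
  have hUs : IsSmooth U := hU.smooth_velocity.isSmooth_slice (mem_univ t)
  have hwt : IsSmooth (fun y => u t y - U y) := hut.sub hUs
  have hqt : IsSmooth (fun y => p t y - q y) :=
    (hu.smooth_pressure.isSmooth_slice ht).sub (hU.smooth_pressure.isSmooth_slice (mem_univ t))
  have hdivw : IsDivFree (fun y => u t y - U y) := by
    intro x
    have hw : (fun y => u t y - U y) = u t - U := rfl
    rw [hw, Torus.divergence_sub (hut.isContDiff (by simp)) (hUs.isContDiff (by simp)),
      hu.divFree t ht x, hU.divFree t (mem_univ t) x, sub_zero]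
  have hderiv : ∀ x, timeDerivWithin S (fun s y => u s y - U y) t x =
      ν • Torus.laplacian (fun y => u t y - U y) x -
        (Torus.convect (u t) (fun y => u t y - U y) x +
          Torus.convect (fun y => u t y - U y) U x) -
        Torus.gradient (fun y => p t y - q y) x :=
    fun x => perturbationEnergyBalance_timeDerivWithin_eq hU hu hSU ht x
  -- integrability of the four terms
  have hi0 : Integrable (fun x => ⟪Torus.laplacian (fun y => u t y - U y) x, u t x - U x⟫_ℝ)
      volume := (hwt.laplacian.inner hwt).integrable
  have hi1 : Integrable
      (fun x => ⟪Torus.convect (u t) (fun y => u t y - U y) x, u t x - U x⟫_ℝ) volume :=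
    ((hut.convect hwt).inner hwt).integrable
  have hi2 : Integrable
      (fun x => ⟪Torus.convect (fun y => u t y - U y) U x, u t x - U x⟫_ℝ) volume :=
    ((hwt.convect hUs).inner hwt).integrable
  have hi3 : Integrable
      (fun x => ⟪Torus.gradient (fun y => p t y - q y) x, u t x - U x⟫_ℝ) volume :=
    (hqt.gradient.inner hwt).integrable
  have hi12 : Integrable (fun x => ⟪Torus.convect (u t) (fun y => u t y - U y) x, u t x - U x⟫_ℝ +
      ⟪Torus.convect (fun y => u t y - U y) U x, u t x - U x⟫_ℝ) volume := hi1.add hi2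
  have hiν : Integrable
      (fun x => ν * ⟪Torus.laplacian (fun y => u t y - U y) x, u t x - U x⟫_ℝ) volume :=
    hi0.const_mul ν
  have hiF : Integrable (fun x => ν * ⟪Torus.laplacian (fun y => u t y - U y) x, u t x - U x⟫_ℝ -
      (⟪Torus.convect (u t) (fun y => u t y - U y) x, u t x - U x⟫_ℝ +
        ⟪Torus.convect (fun y => u t y - U y) U x, u t x - U x⟫_ℝ)) volume := hiν.sub hi12
  have hcomm : ∫ x, ⟪u t x - U x, Torus.convect (fun y => u t y - U y) U x⟫_ℝ =
      ∫ x, ⟪Torus.convect (fun y => u t y - U y) U x, u t x - U x⟫_ℝ :=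
    integral_congr_ae (ae_of_all _ fun x => real_inner_comm _ _)
  rw [hcomm]
  simp_rw [hderiv, inner_sub_left, inner_add_left, real_inner_smul_left]
  rw [integral_sub hiF hi3, integral_sub hiν hi12, integral_const_mul, integral_add hi1 hi2,
    integral_inner_convect_self_right_eq_zero hut (hu.divFree t ht) hwt,
    integral_inner_gradient_eq_zero_of_isDivFree hwt hqt hdivw,
    integral_inner_laplacian_self_eq_neg_gradNormSq_of_isSmooth hwt]
  ring

end PerturbationEnergyBalance

/-- **Serrin's perturbation-energy identity** (registered stub `stub_perturbationEnergyBalance` of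
the line `laminar-burst-shadowing` for the crux `DopplerClock.QuadratureStressFloor`). For a steady
classical solution `(U, q)` of the forced system `NS_ν(f)` on `T³` and any classical solution `(u, p)`
of the same forced system on a convex time set `S`, the perturbation energy `s ↦ ½‖u(s) − U‖₂²` has
within `S` at every `t ∈ S` the one-sided derivative
`−ν‖∇(u(t) − U)‖₂² − ∫ ⟪u(t) − U, ((u(t) − U)·∇)U⟫` (force and pressure drop out; the cubic
transport term vanishes by incompressibility). At a point of `S` which is not an accumulation point
the claim is vacuous; otherwise `S` is a set of unique differentiability and the identity is
`perturbationEnergyBalance_integral_inner_timeDerivWithin` after differentiating under the integral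
(J. Serrin, Arch. Rational Mech. Anal. 3 (1959), §2; Majda–Bertozzi 2002, Prop. 3.1). [folklore] -/
theorem stub_perturbationEnergyBalance :
    ∀ (ν : ℝ) (S : Set ℝ) (f U : UnitAddTorus (Fin 3) → EuclideanSpace ℝ (Fin 3))
      (q : UnitAddTorus (Fin 3) → ℝ) (u : ℝ → UnitAddTorus (Fin 3) → EuclideanSpace ℝ (Fin 3))
      (p : ℝ → UnitAddTorus (Fin 3) → ℝ), Convex ℝ S →
      Literature.Analysis.FunctionSpaces.Torus.IsClassicalNSSolutionOn Set.univ ν (fun _ => f) (fun _ => U)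
        (fun _ => q) →
      Literature.Analysis.FunctionSpaces.Torus.IsClassicalNSSolutionOn S ν (fun _ => f) u p →
      ∀ t ∈ S, HasDerivWithinAt
        (fun s => Literature.Analysis.FunctionSpaces.Torus.kineticEnergy (fun x => u s x - U x))
        (-(ν * Literature.Analysis.FunctionSpaces.Torus.gradNormSq (fun x => u t x - U x)) -
          ∫ x, inner ℝ (u t x - U x)
            (Literature.Analysis.FunctionSpaces.Torus.convect (fun y => u t y - U y) U x)) S t := by
  intro ν S f U q u p hS hU hu t ht
  by_cases hacc : AccPt t (𝓟 S)
  swap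
  · exact HasFDerivWithinAt.of_not_accPt hacc
  have hSU : UniqueDiffOn ℝ S :=
    uniqueDiffOn_convex hS (interior_nonempty_of_convex_of_accPt hS ht hacc)
  have hw : IsSmoothSpaceTimeOn S (fun s y => u s y - U y) :=
    hu.smooth_velocity.sub (hU.smooth_velocity.mono (subset_univ S))
  -- differentiate the perturbation energy under the integral sign
  have hφ : IsSmoothSpaceTimeOn S (fun s x => ‖u s x - U x‖ ^ 2) := by
    change ContDiffOn ℝ ∞ (fun z => ‖stLift (fun s y => u s y - U y) z‖ ^ 2) (S ×ˢ univ)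
    exact hw.norm_sq ℝ
  have hE : HasDerivWithinAt (fun s => kineticEnergy (fun x => u s x - U x))
      (2⁻¹ * ∫ x, timeDerivWithin S (fun s x => ‖u s x - U x‖ ^ 2) t x) S t :=
    (hφ.hasDerivWithinAt_integral hS ht).const_mul 2⁻¹
  -- `∂ₜ‖w‖² = 2⟪∂ₜw, w⟫`
  have htd : ∀ x, timeDerivWithin S (fun s x => ‖u s x - U x‖ ^ 2) t x =
      2 * ⟪timeDerivWithin S (fun s y => u s y - U y) t x, u t x - U x⟫_ℝ := by
    intro x
    have h2 := ((hw.hasDerivWithinAt_slice ht x).norm_sq).derivWithin (hSU t ht)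
    rw [real_inner_comm] at h2
    exact h2
  have hE' : 2⁻¹ * ∫ x, timeDerivWithin S (fun s x => ‖u s x - U x‖ ^ 2) t x =
      ∫ x, ⟪timeDerivWithin S (fun s y => u s y - U y) t x, u t x - U x⟫_ℝ := by
    simp_rw [htd, integral_const_mul]
    ring
  rw [hE', perturbationEnergyBalance_integral_inner_timeDerivWithin hU hu hSU ht] at hE
  exact hE

end Summit.AnomalousDissipation.AnomalousDissipation.Theorems

end
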